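import Mathlib.Topology.UniformSpace.LocallyUniformConvergence
import Mathlib.Analysis.InnerProductSpace.PiL2
import Mathlib.Algebra.Order.Floor.Ring
import Literature.Probability.LatticeModels.LatticeGraph
import HarnessLib

-- provenance: harness21/H21/H21/Prelude/StatMech/ScalingLimit.lean @ 6de89a0 (interim HEAD d8f2665); M5 mechanical rewrite
/-!
# Pointwise scaling limits of rescaled lattice correlators

Trunk: StatMech (prelude item P8 `ScalingLimit`, notion `pointwise_scaling_limit_correlators`).

Given a family of lattice `n`-point functions `G n : (Fin n → ℤ^d) → ℝ` (e.g. the critical Ising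
spin correlations `⟨σ_{x₁} ⋯ σ_{xₙ}⟩_{β_c}`) and a renormalisation `ρ : ℝ → ℝ` (a function of the
mesh `δ`), the *rescaled correlator* at mesh `δ > 0` is the function on `(ℝ^d)^n`
`x ↦ ρ(δ)^n · G n ([x₁/δ], …, [xₙ/δ])`, where `[·/δ]` is the coordinatewise integer part.
The predicate `HasPointwiseScalingLimit G ρ S` says that for every `n` these functions converge,
as `δ → 0⁺`, locally uniformly on the open set of non-coincident configurations
`{x : (ℝ^d)^n | xᵢ ≠ xⱼ for i ≠ j}` to `S n`. We also define the connected four-point function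
`U₄` of the limit, non-degeneracy of `S 2` and non-triviality of `U₄`, which are the clauses of the
peak statement of `summits/crit-ising3d/SUMMIT.md` ('S'), whose shape is that of
Chelkak–Hongler–Izyurov, *Conformal invariance of spin correlations in the planar Ising model*,
Ann. Math. 181 (2015), Thm 1.1, transposed to `ℝ^d`.

Mathlib anchors used: `TendstoLocallyUniformlyOn`, `nhdsWithin` (`𝓝[>] 0`), `Int.floor`,
`EuclideanSpace`, `Function.Injective`. Mathlib has no "configuration space of distinct points"
nor its openness (searched `Injective`/`IsOpen` in `Mathlib/Topology`), hence `NonCoincident` and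
`isOpen_nonCoincident` below.

Design choices: points of `ℝ^d` are `EuclideanSpace ℝ (Fin d)` (so that the Möbius/rotation
predicates of P9 apply); coordinates are read through the `WithLp` coercion `x i`. The mesh filter
is `𝓝[>] (0 : ℝ)`; values of `ρ` and of the rescaled correlator at `δ ≤ 0` are irrelevant.
-/

namespace Literature.Probability.LatticeModels

open Filter Topology

variable {d : ℕ}

/-- A family of lattice `n`-point functions on `ℤ^d`, `G n (x₁, …, xₙ)` (e.g.
`⟨σ_{x₁} ⋯ σ_{xₙ}⟩_{β_c}`), indexed by `n : ℕ` and `x : Fin n → Site d`.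
(summits/crit-ising3d/SUMMIT.md 'S'; Chelkak–Hongler–Izyurov 2015, Thm 1.1.) [cite: ChelkakHonglerIzyurov2015, Thm 1.1] -/
abbrev LatticeCorrFamily (d : ℕ) : Type := (n : ℕ) → (Fin n → Site d) → ℝ

/-- A family of continuum `n`-point functions on `ℝ^d`, `S n (x₁, …, xₙ)`, indexed by `n : ℕ` and
`x : Fin n → EuclideanSpace ℝ (Fin d)`.
(summits/crit-ising3d/SUMMIT.md 'S'; Chelkak–Hongler–Izyurov 2015, Thm 1.1.) [cite: ChelkakHonglerIzyurov2015, Thm 1.1] -/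
abbrev CorrFamily (d : ℕ) : Type := (n : ℕ) → (Fin n → EuclideanSpace ℝ (Fin d)) → ℝ

/-- The configuration space of `n` pairwise distinct (non-coincident) points of `ℝ^d`,
`{x : (ℝ^d)^n | xᵢ ≠ xⱼ for i ≠ j}`, i.e. the injective `x : Fin n → ℝ^d`.
(summits/crit-ising3d/SUMMIT.md 'S'; Chelkak–Hongler–Izyurov 2015, Thm 1.1.) [cite: ChelkakHonglerIzyurov2015, Thm 1.1] -/
def NonCoincident (d n : ℕ) : Set (Fin n → EuclideanSpace ℝ (Fin d)) :=
  {x | Function.Injective x}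

/-- Membership in `NonCoincident d n` is injectivity. (summits/crit-ising3d/SUMMIT.md 'S'.) [folklore] -/
@[simp] theorem mem_nonCoincident {n : ℕ} (x : Fin n → EuclideanSpace ℝ (Fin d)) :
    x ∈ NonCoincident d n ↔ Function.Injective x := Iff.rfl

/-- The set of non-coincident configurations is open in `(ℝ^d)^n` (a finite intersection of the
open sets `{xᵢ ≠ xⱼ}`). (Folklore; cf. Chelkak–Hongler–Izyurov 2015, Thm 1.1.) [cite: ChelkakHonglerIzyurov2015, Thm 1.1] -/
theorem isOpen_nonCoincident (d n : ℕ) : IsOpen (NonCoincident d n) := by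
  simp only [NonCoincident, Function.Injective, Set.setOf_forall]
  refine isOpen_iInter_of_finite fun i => isOpen_iInter_of_finite fun j => ?_
  by_cases h : i = j
  · simp [h]
  · simp only [h, imp_false]
    exact isOpen_ne_fun (continuous_apply i) (continuous_apply j)

/-- The lattice approximation at mesh `δ` of a point `x ∈ ℝ^d`: the site `[x/δ] ∈ ℤ^d` with
coordinates `⌊xᵢ / δ⌋`. (summits/crit-ising3d/SUMMIT.md 'S', `σ_{[x/δ]}`;
Chelkak–Hongler–Izyurov 2015, §1.) [cite: ChelkakHonglerIzyurov2015, §1] -/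
noncomputable def latticeApprox (δ : ℝ) (x : EuclideanSpace ℝ (Fin d)) : Site d :=
  fun i => ⌊x i / δ⌋

/-- Coordinates of the lattice approximation. (summits/crit-ising3d/SUMMIT.md 'S'.) [folklore] -/
@[simp] theorem latticeApprox_apply (δ : ℝ) (x : EuclideanSpace ℝ (Fin d)) (i : Fin d) :
    latticeApprox δ x i = ⌊x i / δ⌋ := rfl

/-- The rescaled, renormalised `n`-point correlator at mesh `δ`:
`x ↦ ρ(δ)^n · G n ([x₁/δ], …, [xₙ/δ])`, a function on `(ℝ^d)^n`.
(summits/crit-ising3d/SUMMIT.md 'S'; Chelkak–Hongler–Izyurov 2015, Thm 1.1, where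
`ρ(δ) = δ^{-1/8}`.) [cite: ChelkakHonglerIzyurov2015, Thm 1.1  where  ρ(δ] -/
noncomputable def rescaledCorrelator (G : LatticeCorrFamily d) (ρ : ℝ → ℝ) (n : ℕ) (δ : ℝ)
    (x : Fin n → EuclideanSpace ℝ (Fin d)) : ℝ :=
  ρ δ ^ n * G n (fun i => latticeApprox δ (x i))

/-- Unfolding of `rescaledCorrelator`. (summits/crit-ising3d/SUMMIT.md 'S'.) [folklore] -/
theorem rescaledCorrelator_apply (G : LatticeCorrFamily d) (ρ : ℝ → ℝ) (n : ℕ) (δ : ℝ)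
    (x : Fin n → EuclideanSpace ℝ (Fin d)) :
    rescaledCorrelator G ρ n δ x = ρ δ ^ n * G n (fun i => latticeApprox δ (x i)) := rfl

/-- **Pointwise scaling limit.** The lattice family `G`, renormalised by `ρ`, has scaling limit
`S`: for every `n`, `ρ(δ)^n G n ([x₁/δ], …, [xₙ/δ]) → S n (x₁, …, xₙ)` as `δ → 0⁺`, locally
uniformly on the non-coincident configurations `x ∈ (ℝ^d)^n`.
(summits/crit-ising3d/SUMMIT.md 'S'; Chelkak–Hongler–Izyurov 2015, Thm 1.1.) [cite: ChelkakHonglerIzyurov2015, Thm 1.1] -/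
def HasPointwiseScalingLimit (G : LatticeCorrFamily d) (ρ : ℝ → ℝ) (S : CorrFamily d) : Prop :=
  ∀ n, TendstoLocallyUniformlyOn (rescaledCorrelator G ρ n) (S n) (𝓝[>] (0 : ℝ))
    (NonCoincident d n)

/-- The connected (Ursell) four-point function of a family `S` with vanishing odd correlations:
`U₄(x₀,x₁,x₂,x₃) = S₄(x₀,x₁,x₂,x₃) − S₂(x₀,x₁)S₂(x₂,x₃) − S₂(x₀,x₂)S₂(x₁,x₃) − S₂(x₀,x₃)S₂(x₁,x₂)`.
(summits/crit-ising3d/SUMMIT.md 'S' (iii); Aizenman, Comm. Math. Phys. 86 (1982), §1.) [folklore] -/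
def limitConnectedFour (S : CorrFamily d) (x : Fin 4 → EuclideanSpace ℝ (Fin d)) : ℝ :=
  S 4 x - (S 2 ![x 0, x 1] * S 2 ![x 2, x 3] + S 2 ![x 0, x 2] * S 2 ![x 1, x 3]
    + S 2 ![x 0, x 3] * S 2 ![x 1, x 2])

/-- Non-degeneracy of the two-point function: `0 < S₂(x, y)` for all `x ≠ y` (finiteness being
automatic for a real-valued `S`). (summits/crit-ising3d/SUMMIT.md 'S' (i).) [folklore] -/
def IsNondegenerateTwoPoint (S : CorrFamily d) : Prop :=
  ∀ x ∈ NonCoincident d 2, 0 < S 2 x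

/-- Non-triviality (non-Gaussianity) of the limit: the connected four-point function `U₄` is not
identically zero on non-coincident configurations. (summits/crit-ising3d/SUMMIT.md 'S' (iii);
Aizenman, Comm. Math. Phys. 86 (1982), §1.) [folklore] -/
def HasNontrivialU4 (S : CorrFamily d) : Prop :=
  ∃ x ∈ NonCoincident d 4, limitConnectedFour S x ≠ 0

end Literature.Probability.LatticeModels
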